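import Summits.BirchSwinnertonDyer.BirchSwinnertonDyer.Theses.KatoDescentPotSupersingular
import Summits.BirchSwinnertonDyer.BirchSwinnertonDyer.Theorems.KatoDescentPotSupersingularReducibleKatoMemberOfZetaInputsNodes
import HarnessLib

/-!
# Route `KatoDescentPotSupersingular` (rung K9, cell `bsd-potss`): the crux `ReducibleKatoMember`
# (item stmt-BirchSwinnertonDyer-19196, shared with K8-t′) FROM THE ZETA-ONLY INPUTS AT KATO'S MEMBER —
# thin route-typed restatement of the route-free node theorem
# `Theorems.ReducibleOfZetaInputs.katoMemberShaBoundOfReducible_of_memberHullZetaInputs`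

Seat `bsd-potss-rkm` generation 10.  The crux M of the route is, by name, the cell's node
`Summit.BirchSwinnertonDyer.Rank1Residual.O6.KatoMemberShaBoundOfReducible` (T-X3K).  The route-free
module `KatoDescentPotSupersingularReducibleKatoMemberOfZetaInputsNodes.lean` derives it from THREE named
Literature facts — `ModularForms.exists_isNewformOf` (modularity), `Kato2004.exists_memberHullZetaInputs`
(the ZETA-ONLY re-type p519008 of the held input `exists_memberHullInputs` 19659: Kato Thm. 12.5 (1)–(3),
12.6 + 13.10 (1) + 13.14, §14.14, 14.5 (2), 14.16 (2) + §14.8, Wuthrich L.14 at `T = V_{ℤ_p}(f)(1)`,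
WITHOUT the four tree-proved algebraic clauses `finite_H`, `torsionFree_H`, `ι_injective`,
`finite_coinvariants_H2`) and Gross–Zagier–Kolyvagin `rank_eq_analyticRank_of_analyticRank_le_one`
(already the route's held input `PublishedInputRankEqAnalyticRankW`) — discharging (R0) by
`IntegralH1RankZero.rank_integralH1_layerZero_le_one` (rkm g9) and `nonempty_iwasawaH1Data` by its
`_holds` (rkm g4).  This file only restates that theorem with the K9 route decl as its type, in the
shapes the planner's resplit glue `ReducibleKatoMemberOfZetaInputs : PublishedInputIwasawaH1Data →
PublishedInputNewformKato → PublishedInputMemberHullZetaInputs → PublishedInputRankEqAnalyticRankW →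
ReducibleKatoMember` consumes: its closer is the one-liner
`fun h₁ h₂ h₃ h₄ => reducibleKatoMember_of_zetaInputs h₁ h₂ h₃ h₄` (every alias unfolds by `rfl`).
CONDITIONAL (audit `proof.conditional`); the item is NOT closed by this file.  HONEST FRAMING: BSD is not
advanced; nothing is booked; the trust base of M becomes {modularity, GZK, the zeta-only transcription}.

References: [Kato2004Asterisque] Thm. 12.5–12.6 (pp. 221–222), Lemma 13.10 (1) (p. 230), 13.14 (p. 234),
Thm. 14.5 (p. 236), §14.14–14.15 (pp. 243–244), Prop. 14.16 (2) (p. 244); [Wuthrich2014] Lemma 14;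
[Darmon2004] Thm. 3.22; [DiamondShurman2005] Thm. 8.8.3.
-/

set_option autoImplicit false
-- sibling precedent (`KatoDescentPotSupersingularReducibleKatoMemberOfInputs.lean`): the directory name
-- repeats the summit name
set_option linter.dupNamespace false

noncomputable section

namespace Summit.BirchSwinnertonDyer.BirchSwinnertonDyer.Theorems

open Literature.NumberTheory.EllipticCurves Literature.NumberTheory.EllipticCurves.ModularForms
  Literature.NumberTheory.EllipticCurves.Kato2004

/-- **The K9 crux `ReducibleKatoMember` (item stmt-BirchSwinnertonDyer-19196; type = the route decl
verbatim) from the zeta-only inputs**: `exists_isNewformOf → exists_memberHullZetaInputs →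
rank_eq_analyticRank_of_analyticRank_le_one → ReducibleKatoMember`, by the route-free node theorem
`ReducibleOfZetaInputs.katoMemberShaBoundOfReducible_of_memberHullZetaInputs` (the route decl is
definitionally the node `O6.KatoMemberShaBoundOfReducible`).  Conditional on the three named Literature
facts; the item is not closed by this theorem.
[cite: Kato2004Asterisque, Thm. 12.6 (p. 222), §14.14 and Lemma 14.15 (pp. 243–244), Prop. 14.16 (2) (p. 244)]
[cite: Wuthrich2014, Lemma 14 (p. 396)] [cite: Darmon2004, Thm. 3.22] -/
theorem reducibleKatoMember_of_memberHullZetaInputs (hmod : exists_isNewformOf)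
    (hZ : Kato2004.exists_memberHullZetaInputs) (hGZK : rank_eq_analyticRank_of_analyticRank_le_one) :
    Summit.BirchSwinnertonDyer.BirchSwinnertonDyer.Theses.KatoDescentPotSupersingular.ReducibleKatoMember :=
  ReducibleOfZetaInputs.katoMemberShaBoundOfReducible_of_memberHullZetaInputs hmod hZ hGZK

/-- **Glue-shaped form** (the closer of the planner's resplit glue `ReducibleKatoMemberOfZetaInputs`, in
the order `PublishedInputIwasawaH1Data → PublishedInputNewformKato → PublishedInputMemberHullZetaInputs →
PublishedInputRankEqAnalyticRankW → ReducibleKatoMember`; each alias unfolds by `rfl` to the named fact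
below, so the glue is `fun h₁ h₂ h₃ h₄ => reducibleKatoMember_of_zetaInputs h₁ h₂ h₃ h₄`):
`nonempty_iwasawaH1Data → exists_isNewformOf → exists_memberHullZetaInputs →
rank_eq_analyticRank_of_analyticRank_le_one → ReducibleKatoMember` (the first hypothesis is a theorem
and is not used).  Conditional; nothing else assumed.
[cite: Kato2004Asterisque, Thm. 12.6 (p. 222), Prop. 14.16 (2) (p. 244)] [cite: Wuthrich2014, Lemma 14 (p. 396)] -/
theorem reducibleKatoMember_of_zetaInputs (_hne : Kato2004.nonempty_iwasawaH1Data)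
    (hmod : exists_isNewformOf) (hZ : Kato2004.exists_memberHullZetaInputs)
    (hGZK : rank_eq_analyticRank_of_analyticRank_le_one) :
    Summit.BirchSwinnertonDyer.BirchSwinnertonDyer.Theses.KatoDescentPotSupersingular.ReducibleKatoMember :=
  reducibleKatoMember_of_memberHullZetaInputs hmod hZ hGZK

/-- **Conjunction form**: `(exists_isNewformOf ∧ exists_memberHullZetaInputs ∧
rank_eq_analyticRank_of_analyticRank_le_one) → ReducibleKatoMember`.  Conditional; nothing else assumed.
[cite: Kato2004Asterisque, Thm. 12.6 (p. 222), Prop. 14.16 (2) (p. 244)] [cite: Wuthrich2014, Lemma 14 (p. 396)] -/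
theorem reducibleKatoMember_of_zetaInputs_and
    (h : exists_isNewformOf ∧ Kato2004.exists_memberHullZetaInputs ∧
      rank_eq_analyticRank_of_analyticRank_le_one) :
    Summit.BirchSwinnertonDyer.BirchSwinnertonDyer.Theses.KatoDescentPotSupersingular.ReducibleKatoMember :=
  reducibleKatoMember_of_memberHullZetaInputs h.1 h.2.1 h.2.2

end Summit.BirchSwinnertonDyer.BirchSwinnertonDyer.Theorems

end
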